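import Summits.CriticalPhenomena.PercolationContinuityZ3.Theorems.PercNearOneGluingNoHeavyLowerTailLonelyRelay
import HarnessLib

/-!
# `NoHeavyLowerTail` (stmt-CriticalPhenomena-4575) — the one-cut bound at `|A| = 5`: typed statement, and its
# reduction to the TWO-FINGER bound `X′(5)` and cumulative isolation `CIL₂(5)`

Support file (prover seat `prim-a5-assembly-1`, `--supports stmt-CriticalPhenomena-4575`; companion memo
`run/shared/lean/prim/prim-a5/ASSEMBLY.md`).  No sorries, no named facts, standard axioms; three `Prop` definitions
naming verbatim expressions of the crux's registered stubs, and their bookkeeping.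

Setting: `μ = prodBernoulli w` on `Fin n`, a relay set `A` with `A.card = 5`, an observer `o` (which MAY be a relay),
`N = #{a ∈ A : o ↔ a}`, `E N = Σ_{a∈A} μ(o ↔ a)`, and for a relay `a` its block `T_a = {x ∈ A : a ↔ x} ∋ a`.

* `OneCutFive.OneCut5` — the `|A| = 5` instance of the registered stub `stub_oneCut` of the crux ("oneCut(5)"):
  `μ{1 ≤ N < E N/2} ≤ t` whenever every relay–relay cut has probability `≤ t`.  PROVED elsewhere for `n ≤ 6`
  (`Theorems.oneCut5_le_six`, certificate-checked) and whenever `E N ≤ 4` (`Theorems.oneCut_of_sum_le_four`, any `|A|`);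
  OPEN for `n ≥ 7`, `E N > 4` (the event is then `{N ∈ {1,2}}`, `card_filter_le_two_of_lt_half`).
* `OneCutFive.TwoFingerBound` — `X′(5)` (weak form): if SOME vertex `o` has `E N > 4` then for EVERY relay `a`,
  `μ{|T_a| ≤ 2} ≤ t` whenever all relay–relay cuts are `≤ t`; `TwoFingerHub` — the strong form with only the cuts at `a`
  (`twoFingerBound_of_twoFingerHub`).  Census (prim-cplus-coupling kit j039743): 0 violations / 220 598 exact instances with
  `E N > 4`, worst margin exactly `0` (pendant relay / glued observer); constant `4/3` is Markov; OPEN.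
* `OneCutFive.CIL25` — cumulative isolation at `(k, j) = (5, 2)`, the `A.card = 5`, `j = 2` instance of the registered
  stub `stub_cumulativeIsolation`: for `o ∉ A` some relay `a` has `μ{1 ≤ N ≤ 2} ≤ μ{|T_a| ≤ 2}`; OPEN (census-clean).
RESULTS: `oneCut5_of_twoFingerBound_of_cil25 : TwoFingerBound → CIL25 → OneCut5` (for `o ∈ A` only `TwoFingerBound` at
`a = o` is used: `oneCut5_at_of_mem`), and conversely `twoFinger_at_observer_of_oneCut5` (for `o ∈ A` the one-cut bound IS
the two-finger bound at `a = o`).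

WHAT THIS FILE DELIBERATELY DOES NOT DO (ASSEMBLY.md §1–§3): it does not take SHK3⁺ (`ThreePointLBSwitching.sahiE3_pairSep_nonneg`,
proved), E1 (`hybridSepRow_holds`, proved) or the E3GRP rows (`E3GroupSepCert.RowHolds`) as hypotheses — no proof term for the
`|A| = 5` one-cut bound that uses them is known; in the tree those three form a chain whose sink is SHK3⁺ itself.
[cite: KozmaNitzan2024, Lemma 2 (p. 6) (the `j = 1` level, used via `oneCut_of_sum_le_four`)]
-/

noncomputable section

namespace Summit.CriticalPhenomena.PercolationContinuityZ3.Theorems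

open MeasureTheory Set Literature.Probability.LatticeModels Literature.Probability.Percolation
open scoped Classical BigOperators

namespace OneCutFive

/-- **oneCut(5)**: the one-cut bound of the crux's engine at `|A| = 5` — for every weighted graph, relay set `A` with
`A.card = 5`, observer `o` and `t ≥ 0` bounding all relay–relay cuts, `μ{1 ≤ N ∧ N < E N / 2} ≤ t`
(the statement of `Theorems.oneCut5_le_six` without the hypothesis `n ≤ 6`); OPEN for `n ≥ 7` (conjectured in this programme as the
sharp-constant form of the crux's engine; the level-`1` content is Kozma–Nitzan's Lemma 2).
[cite: KozmaNitzan2024, Lemma 2 (p. 6) (level 1; the |A| = 5 statement is ours)] [status: open] -/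
@[conjecture] def OneCut5 : Prop :=
  ∀ (n : ℕ) (w : Sym2 (Fin n) → unitInterval) (A : Finset (Fin n)) (o : Fin n) (t : ℝ), A.card = 5 → 0 ≤ t →
    (∀ a ∈ A, ∀ a' ∈ A, a ≠ a' → (prodBernoulli w).real (openConn a a')ᶜ ≤ t) →
    (prodBernoulli w).real {ω : BondConfig (Fin n) |
        1 ≤ (A.filter fun a => ω ∈ openConn o a).card ∧
        ((A.filter fun a => ω ∈ openConn o a).card : ℝ) <
          (∑ a ∈ A, (prodBernoulli w).real (openConn o a)) / 2} ≤ t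

/-- **`X′(5)`, weak form (two-finger bound).**  If some vertex `o` (possibly a relay) has `E N = Σ_{x∈A} μ(o ↔ x) > 4`,
then for every relay `a ∈ A` and every `t ≥ 0` bounding all relay–relay cuts, `μ{|T_a| ≤ 2} ≤ t`,
`T_a = {x ∈ A : a ↔ x}`.  OPEN (conjectured in this programme, prim-cplus-coupling LEMMA X′; census-validated, tight).
[cite: KozmaNitzan2024, Lemma 2 (p. 6) (level 1; the level-2 statement is ours)] [status: open] -/
@[conjecture] def TwoFingerBound : Prop :=
  ∀ (n : ℕ) (w : Sym2 (Fin n) → unitInterval) (A : Finset (Fin n)) (o : Fin n), A.card = 5 →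
    4 < ∑ x ∈ A, (prodBernoulli w).real (openConn o x) →
    ∀ a ∈ A, ∀ t : ℝ, 0 ≤ t → (∀ b ∈ A, ∀ b' ∈ A, b ≠ b' → (prodBernoulli w).real (openConn b b')ᶜ ≤ t) →
      (prodBernoulli w).real {ω : BondConfig (Fin n) | (A.filter fun x => ω ∈ openConn a x).card ≤ 2} ≤ t

/-- **`X′(5)`, strong form (two-finger HUB bound)**: as `TwoFingerBound` but with `t` bounding only the cuts AT `a`,
`μ(a ↮ b) ≤ t` for `b ∈ A ∖ a` (prim-cplus-coupling, LEMMA X′).  OPEN (conjectured in this programme; census-validated, tight).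
[cite: KozmaNitzan2024, Lemma 2 (p. 6) (level 1; the level-2 statement is ours)] [status: open] -/
@[conjecture] def TwoFingerHub : Prop :=
  ∀ (n : ℕ) (w : Sym2 (Fin n) → unitInterval) (A : Finset (Fin n)) (o : Fin n), A.card = 5 →
    4 < ∑ x ∈ A, (prodBernoulli w).real (openConn o x) →
    ∀ a ∈ A, ∀ t : ℝ, 0 ≤ t → (∀ b ∈ A, b ≠ a → (prodBernoulli w).real (openConn a b)ᶜ ≤ t) →
      (prodBernoulli w).real {ω : BondConfig (Fin n) | (A.filter fun x => ω ∈ openConn a x).card ≤ 2} ≤ t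

/-- **`CIL₂(5)`**: cumulative isolation at level `2` for five relays — the `A.card = 5`, `j = 2` instance of the
registered stub `stub_cumulativeIsolation`: for an observer outside `A` some relay's block is at least as likely to be
small as the observer's pocket is to be a nonempty minority ("maximum principle" at level 2).  OPEN (conjectured in this
programme, lead of the one-cut line 2026-08-18; census-validated).
[cite: KozmaNitzan2024, Lemma 2 (p. 6) (level 1 = lonely relay; the level-2 statement is ours)] [status: open] -/
@[conjecture] def CIL25 : Prop :=
  ∀ (n : ℕ) (w : Sym2 (Fin n) → unitInterval) (A : Finset (Fin n)) (o : Fin n), A.card = 5 → o ∉ A →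
    ∃ a ∈ A, (prodBernoulli w).real {ω : BondConfig (Fin n) |
        1 ≤ (A.filter fun x => ω ∈ openConn o x).card ∧ (A.filter fun x => ω ∈ openConn o x).card ≤ 2} ≤
      (prodBernoulli w).real {ω : BondConfig (Fin n) | (A.filter fun x => ω ∈ openConn a x).card ≤ 2}

variable {n : ℕ}

/-- The strong form implies the weak form (restrict the cut hypothesis to the pairs at `a`). [this work] -/
theorem twoFingerBound_of_twoFingerHub (h : TwoFingerHub) : TwoFingerBound := by
  intro n w A o hA hEN a ha t ht hcut
  exact h n w A o hA hEN a ha t ht fun b hb hba => hcut a ha b hb (Ne.symm hba)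

/-- `E N ≤ |A|`: the mean relay count is at most the number of relays. [folklore] -/
theorem sum_real_openConn_le_card (w : Sym2 (Fin n) → unitInterval) (A : Finset (Fin n)) (o : Fin n) :
    (∑ x ∈ A, (prodBernoulli w).real (openConn o x)) ≤ (A.card : ℝ) := by
  calc (∑ x ∈ A, (prodBernoulli w).real (openConn o x)) ≤ ∑ _x ∈ A, (1 : ℝ) :=
        Finset.sum_le_sum fun x _ => measureReal_le_one
    _ = (A.card : ℝ) := by simp

/-- For five relays the minority event `{1 ≤ N < E N/2}` lies in `{1 ≤ N ≤ 2}` (`E N ≤ 5`). [this work] -/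
theorem minority_subset_le_two (w : Sym2 (Fin n) → unitInterval) (A : Finset (Fin n)) (o : Fin n) (hA : A.card = 5) :
    {ω : BondConfig (Fin n) | 1 ≤ (A.filter fun a => ω ∈ openConn o a).card ∧
        ((A.filter fun a => ω ∈ openConn o a).card : ℝ) < (∑ a ∈ A, (prodBernoulli w).real (openConn o a)) / 2} ⊆
      {ω : BondConfig (Fin n) | 1 ≤ (A.filter fun x => ω ∈ openConn o x).card ∧
        (A.filter fun x => ω ∈ openConn o x).card ≤ 2} := by
  rintro ω ⟨h1, h2⟩
  refine ⟨h1, ?_⟩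
  have hEN : (∑ a ∈ A, (prodBernoulli w).real (openConn o a)) ≤ 5 := by
    have := sum_real_openConn_le_card w A o
    rw [hA] at this
    exact_mod_cast this
  have h3 : ((A.filter fun a => ω ∈ openConn o a).card : ℝ) < 3 := by linarith
  have h4 : (A.filter fun a => ω ∈ openConn o a).card < 3 := by exact_mod_cast h3
  omega

/-- **oneCut(5) at one instance with the observer a relay, from the two-finger bound at `a = o`.**  If `o ∈ A` and
`E N > 4`, the minority event is contained in `{|T_o| ≤ 2}`. [this work] -/
theorem oneCut5_at_of_mem (hX : TwoFingerBound) (w : Sym2 (Fin n) → unitInterval) (A : Finset (Fin n)) (o : Fin n)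
    (t : ℝ) (hA : A.card = 5) (ho : o ∈ A) (ht : 0 ≤ t)
    (hcut : ∀ a ∈ A, ∀ a' ∈ A, a ≠ a' → (prodBernoulli w).real (openConn a a')ᶜ ≤ t)
    (hEN : 4 < ∑ x ∈ A, (prodBernoulli w).real (openConn o x)) :
    (prodBernoulli w).real {ω : BondConfig (Fin n) |
        1 ≤ (A.filter fun a => ω ∈ openConn o a).card ∧
        ((A.filter fun a => ω ∈ openConn o a).card : ℝ) <
          (∑ a ∈ A, (prodBernoulli w).real (openConn o a)) / 2} ≤ t := by
  have hsub : {ω : BondConfig (Fin n) | 1 ≤ (A.filter fun a => ω ∈ openConn o a).card ∧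
        ((A.filter fun a => ω ∈ openConn o a).card : ℝ) < (∑ a ∈ A, (prodBernoulli w).real (openConn o a)) / 2} ⊆
      {ω : BondConfig (Fin n) | (A.filter fun x => ω ∈ openConn o x).card ≤ 2} :=
    fun ω hω => (minority_subset_le_two w A o hA hω).2
  exact (measureReal_mono hsub).trans (hX n w A o hA hEN o ho t ht hcut)

/-- **Conversely, for `o ∈ A` the one-cut bound IS the two-finger bound at `a = o`**: a relay observer always counts
itself (`N ≥ 1`), and `N < E N/2` iff `N ≤ 2` once `4 < E N ≤ 5`. [this work] -/
theorem twoFinger_at_observer_of_oneCut5 (h5 : OneCut5) (w : Sym2 (Fin n) → unitInterval) (A : Finset (Fin n))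
    (o : Fin n) (t : ℝ) (hA : A.card = 5) (ho : o ∈ A) (ht : 0 ≤ t)
    (hcut : ∀ a ∈ A, ∀ a' ∈ A, a ≠ a' → (prodBernoulli w).real (openConn a a')ᶜ ≤ t)
    (hEN : 4 < ∑ x ∈ A, (prodBernoulli w).real (openConn o x)) :
    (prodBernoulli w).real {ω : BondConfig (Fin n) | (A.filter fun x => ω ∈ openConn o x).card ≤ 2} ≤ t := by
  have hsub : {ω : BondConfig (Fin n) | (A.filter fun x => ω ∈ openConn o x).card ≤ 2} ⊆
      {ω : BondConfig (Fin n) | 1 ≤ (A.filter fun a => ω ∈ openConn o a).card ∧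
        ((A.filter fun a => ω ∈ openConn o a).card : ℝ) < (∑ a ∈ A, (prodBernoulli w).real (openConn o a)) / 2} := by
    intro ω hω
    have hle : (A.filter fun x => ω ∈ openConn o x).card ≤ 2 := hω
    have hoo : o ∈ A.filter fun x => ω ∈ openConn o x :=
      Finset.mem_filter.2 ⟨ho, (SimpleGraph.Reachable.refl o : (openGraph ω).Reachable o o)⟩
    refine ⟨Finset.card_pos.2 ⟨o, hoo⟩, ?_⟩
    have : ((A.filter fun x => ω ∈ openConn o x).card : ℝ) ≤ 2 := by exact_mod_cast hle
    linarith
  exact (measureReal_mono hsub).trans (h5 n w A o t hA ht hcut)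

/-- **THE REDUCTION: oneCut(5) ⟸ X′(5) ∧ CIL₂(5).**  Case `E N ≤ 4`: `Theorems.oneCut_of_sum_le_four` (lonely relay
lemma).  Case `E N > 4`: the minority event lies in `{1 ≤ N ≤ 2}`; if `o ∈ A` it lies in `{|T_o| ≤ 2}` and the two-finger
bound at `a = o` applies; if `o ∉ A`, cumulative isolation moves it to some relay's `{|T_a| ≤ 2}` and the two-finger bound
at `a` applies. [this work] -/
theorem oneCut5_of_twoFingerBound_of_cil25 (hX : TwoFingerBound) (hC : CIL25) : OneCut5 := by
  intro n w A o t hA ht hcut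
  by_cases hEN : (∑ x ∈ A, (prodBernoulli w).real (openConn o x)) ≤ 4
  · exact oneCut_of_sum_le_four n w A o t hEN ht hcut
  · have hEN' : 4 < ∑ x ∈ A, (prodBernoulli w).real (openConn o x) := lt_of_not_ge hEN
    by_cases ho : o ∈ A
    · exact oneCut5_at_of_mem hX w A o t hA ho ht hcut hEN'
    · obtain ⟨a, ha, hle⟩ := hC n w A o hA ho
      calc (prodBernoulli w).real {ω : BondConfig (Fin n) | 1 ≤ (A.filter fun a => ω ∈ openConn o a).card ∧
              ((A.filter fun a => ω ∈ openConn o a).card : ℝ) < (∑ a ∈ A, (prodBernoulli w).real (openConn o a)) / 2}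
          ≤ (prodBernoulli w).real {ω : BondConfig (Fin n) | 1 ≤ (A.filter fun x => ω ∈ openConn o x).card ∧
              (A.filter fun x => ω ∈ openConn o x).card ≤ 2} := measureReal_mono (minority_subset_le_two w A o hA)
        _ ≤ (prodBernoulli w).real {ω : BondConfig (Fin n) | (A.filter fun x => ω ∈ openConn a x).card ≤ 2} := hle
        _ ≤ t := hX n w A o hA hEN' a ha t ht hcut

/-- The same with the strong (hub) form of `X′(5)`. [this work] -/
theorem oneCut5_of_twoFingerHub_of_cil25 (hX : TwoFingerHub) (hC : CIL25) : OneCut5 :=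
  oneCut5_of_twoFingerBound_of_cil25 (twoFingerBound_of_twoFingerHub hX) hC


/-! ## The glued half as ONE exchange row (appended 2026-08-20, prim-a5-assembly-1)

For an observer that is itself a relay (`o ∈ A`), write `k` for another relay (in the census: the one minimising
`μ(o ↔ k)`).  Splitting the two-finger event `{|T_o| ≤ 2}` along `{o ↔ k}`: on `{o ↔ k}` it says that `o` reaches
`k` and no third relay; on `{o ↮ k}` it is part of `{o ↮ k}`, whose other part is `{o ↮ k, |T_o| ≥ 3}`.  Hence the
two-finger bound with `t = μ(o ↮ k)` is EQUIVALENT to the exchange row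
  `(C6)  μ(o ↔ k, |T_o| ≤ 2) ≤ μ(o ↮ k, |T_o| ≥ 3)`
("o reaches k alone no more often than it misses k while reaching two other relays"; companion memo ASSEMBLY.md §8:
0 violations in exact enumeration on `K₆`, `K₇` with `k = argmin μ(o ↔ ·)` and `Σ_{x∈A} μ(o ↔ x) > 4`, equality on the
'1+3' tie family; FALSE for other choices of `k`; FALSE for general increasing events — any proof must use the
two-cluster structure of connectivity events). -/

/-- **Splitting `{|T_o| ≤ 2}` along `{o ↔ k}`**: `μ{|T_o| ≤ 2} = μ(o ↔ k, |T_o| ≤ 2) + μ(o ↮ k, |T_o| ≤ 2)`. [this work] -/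
theorem real_cardLe_two_split (w : Sym2 (Fin n) → unitInterval) (A : Finset (Fin n)) (o k : Fin n) :
    (prodBernoulli w).real {ω : BondConfig (Fin n) | (A.filter fun x => ω ∈ openConn o x).card ≤ 2} =
      (prodBernoulli w).real ({ω : BondConfig (Fin n) | (A.filter fun x => ω ∈ openConn o x).card ≤ 2} ∩ openConn o k) +
      (prodBernoulli w).real ({ω : BondConfig (Fin n) | (A.filter fun x => ω ∈ openConn o x).card ≤ 2} \ openConn o k) :=
  (measureReal_inter_add_sdiff MeasurableSet.of_discrete).symm

/-- **Splitting `{o ↮ k}` along `{|T_o| ≤ 2}`**: `μ(o ↮ k) = μ(o ↮ k, |T_o| ≤ 2) + μ(o ↮ k, 3 ≤ |T_o|)`. [this work] -/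
theorem real_notConn_split (w : Sym2 (Fin n) → unitInterval) (A : Finset (Fin n)) (o k : Fin n) :
    (prodBernoulli w).real (openConn o k)ᶜ =
      (prodBernoulli w).real ({ω : BondConfig (Fin n) | (A.filter fun x => ω ∈ openConn o x).card ≤ 2} \ openConn o k) +
      (prodBernoulli w).real ((openConn o k)ᶜ ∩ {ω : BondConfig (Fin n) | 3 ≤ (A.filter fun x => ω ∈ openConn o x).card}) := by
  have h := (measureReal_inter_add_sdiff (μ := prodBernoulli w) (s := (openConn o k : Set (BondConfig (Fin n)))ᶜ)
    (t := {ω : BondConfig (Fin n) | (A.filter fun x => ω ∈ openConn o x).card ≤ 2})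
    MeasurableSet.of_discrete).symm
  have h1 : ((openConn o k : Set (BondConfig (Fin n)))ᶜ ∩ {ω : BondConfig (Fin n) | (A.filter fun x => ω ∈ openConn o x).card ≤ 2}) =
      ({ω : BondConfig (Fin n) | (A.filter fun x => ω ∈ openConn o x).card ≤ 2} \ openConn o k) := by
    ext ω; simp only [mem_inter_iff, mem_compl_iff, mem_sdiff, mem_setOf_eq]; tauto
  have h2 : ((openConn o k : Set (BondConfig (Fin n)))ᶜ \ {ω : BondConfig (Fin n) | (A.filter fun x => ω ∈ openConn o x).card ≤ 2}) =
      ((openConn o k)ᶜ ∩ {ω : BondConfig (Fin n) | 3 ≤ (A.filter fun x => ω ∈ openConn o x).card}) := by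
    ext ω; simp only [mem_inter_iff, mem_compl_iff, mem_sdiff, mem_setOf_eq, not_le]; constructor
    · rintro ⟨h3, h4⟩; exact ⟨h3, by omega⟩
    · rintro ⟨h3, h4⟩; exact ⟨h3, by omega⟩
  rw [h1, h2] at h
  exact h

/-- **The glued two-finger bound IS the exchange row (C6).**  For any weights, relay set `A`, observer `o` and relay `k`:
`μ{|T_o| ≤ 2} ≤ μ(o ↮ k)` iff `μ(o ↔ k, |T_o| ≤ 2) ≤ μ(o ↮ k, 3 ≤ |T_o|)`.  (Pure bookkeeping; the content of the glued
half of oneCut(5) is the right-hand inequality for `k = argmin μ(o ↔ ·)` under `Σ_{x∈A} μ(o ↔ x) > 4`.) [this work] -/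
theorem twoFinger_at_observer_iff_exchange (w : Sym2 (Fin n) → unitInterval) (A : Finset (Fin n)) (o k : Fin n) :
    (prodBernoulli w).real {ω : BondConfig (Fin n) | (A.filter fun x => ω ∈ openConn o x).card ≤ 2} ≤
        (prodBernoulli w).real (openConn o k)ᶜ ↔
      (prodBernoulli w).real ({ω : BondConfig (Fin n) | (A.filter fun x => ω ∈ openConn o x).card ≤ 2} ∩ openConn o k) ≤
        (prodBernoulli w).real ((openConn o k)ᶜ ∩ {ω : BondConfig (Fin n) | 3 ≤ (A.filter fun x => ω ∈ openConn o x).card}) := by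
  rw [real_cardLe_two_split w A o k, real_notConn_split w A o k]
  constructor
  · intro h; linarith
  · intro h; linarith

/-- **Glued oneCut(5) at one instance from the exchange row.**  If `o ∈ A`, `A.card = 5`, `E N > 4`, all relay–relay
cuts are `≤ t`, and the exchange row (C6) holds for SOME relay `k ∈ A ∖ o`, then the minority event has mass `≤ t`
(the event lies in `{|T_o| ≤ 2}`, which is `≤ μ(o ↮ k) ≤ t`). [this work] -/
theorem oneCut5_at_of_mem_of_exchange (w : Sym2 (Fin n) → unitInterval) (A : Finset (Fin n)) (o k : Fin n) (t : ℝ)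
    (hA : A.card = 5) (ho : o ∈ A) (hk : k ∈ A) (hko : k ≠ o)
    (hcut : ∀ a ∈ A, ∀ a' ∈ A, a ≠ a' → (prodBernoulli w).real (openConn a a')ᶜ ≤ t)
    (hexch : (prodBernoulli w).real ({ω : BondConfig (Fin n) | (A.filter fun x => ω ∈ openConn o x).card ≤ 2} ∩ openConn o k) ≤
        (prodBernoulli w).real ((openConn o k)ᶜ ∩ {ω : BondConfig (Fin n) | 3 ≤ (A.filter fun x => ω ∈ openConn o x).card})) :
    (prodBernoulli w).real {ω : BondConfig (Fin n) |
        1 ≤ (A.filter fun a => ω ∈ openConn o a).card ∧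
        ((A.filter fun a => ω ∈ openConn o a).card : ℝ) <
          (∑ a ∈ A, (prodBernoulli w).real (openConn o a)) / 2} ≤ t := by
  have hsub : {ω : BondConfig (Fin n) | 1 ≤ (A.filter fun a => ω ∈ openConn o a).card ∧
        ((A.filter fun a => ω ∈ openConn o a).card : ℝ) < (∑ a ∈ A, (prodBernoulli w).real (openConn o a)) / 2} ⊆
      {ω : BondConfig (Fin n) | (A.filter fun x => ω ∈ openConn o x).card ≤ 2} :=
    fun ω hω => (minority_subset_le_two w A o hA hω).2
  have _ := ho
  calc (prodBernoulli w).real {ω : BondConfig (Fin n) | 1 ≤ (A.filter fun a => ω ∈ openConn o a).card ∧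
          ((A.filter fun a => ω ∈ openConn o a).card : ℝ) < (∑ a ∈ A, (prodBernoulli w).real (openConn o a)) / 2}
      ≤ (prodBernoulli w).real {ω : BondConfig (Fin n) | (A.filter fun x => ω ∈ openConn o x).card ≤ 2} := measureReal_mono hsub
    _ ≤ (prodBernoulli w).real (openConn o k)ᶜ := (twoFinger_at_observer_iff_exchange w A o k).2 hexch
    _ ≤ t := hcut o ho k hk hko.symm

end OneCutFive

end Summit.CriticalPhenomena.PercolationContinuityZ3.Theorems
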